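import Literature.AnabelianGeometry.SemiGraphs.TemperedDecompositionOfProfinite
import Mathlib.Topology.Algebra.Group.ClosedSubgroup
import HarnessLib

/-!
# [SemiAnbd] Theorem 6.5 (i)(ii)(iv) ⇔ [Mzk8] Theorem 1.3 (i)(ii)(iv) when `Π^temp_{X_K} → Π_{X_K}` is onto

Mochizuki, *Semi-graphs of anabelioids*, Publ. RIMS **42** (2006) [SemiAnbd], §6, Theorem 6.5
(Tempered Decomposition Groups) pp. 71–72, printed proof p. 72: «Assertions (i), (ii), (iv) follow
formally from [Mzk8], Theorem 1.3, (i), (ii), (iv), respectively.» [cite: MochizukiSemiAnbd2006, Thm 6.5 pp.71-72]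
[Mzk8] = S. Mochizuki, *Galois sections in absolute anabelian geometry*, Nagoya Math. J. **179** (2005),
Thm. 1.3 p. 6. [cite: MochizukiGalSect2005, Thm 1.3 p.6]

PROOF-ONLY companion of `TemperedDecompositionOfProfinite.lean` (abc-iut cell, block F, seat abc-iut-f-174,
FACT-LIST row F-1708 `TemperedOrigin.TemperedDecompositionGroupsHolds`; theorems only — no `def`, no
`instance`, no new named fact).  That file reduces the five typed clauses of Thm. 6.5 (i)(ii)(iv) for
`Π^temp_{X_K}` to the five [Mzk8] Thm. 1.3 statements for `D̂_x = ι(D_x)`, `Î_x = D̂_x ∩ Ker(augHat)` in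
the completion `Π_{X_K} = X.PiHat` (binders `h13i`, `h13i'`, `h13ii`, `h13ii'`, `h13iv`).  Here: the
CONVERSE transfer in the regime where `ι = X.toHat` is ONTO (e.g. `Π^temp_{X_K}` compact — the regime of
every kernel MODEL of the interface carrying closed points, abc-iut-w5-d040's genuine §6 data), so that in
that regime the reduction is an EQUIVALENCE (`temperedDecompositionGroups_iff_of_toHat_surjective`):

* the binders are then EXACTLY AS STRONG as the typed clauses (the reduction loses nothing), and
* NON-VACUITY of the five binders jointly with the interface axioms and with closed points present follows
  from any compact model of the Thm. 6.5 clauses by ONE application of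
  `temperedDecompositionGroups_hat_of_toHat_surjective` (e.g. abc-iut-w5-d040's
  `exists_temperedCurve_thm65_package_genuine`, pending at filing time — not imported here).

Ingredients: `Subgroup.map_injective`, `map_le_map_iff_of_injective`, `map_comap_eq_self_of_surjective`
(Mathlib), the cell's `map_mem_commensurator_map_iff`, and — for the second sentence of (ii) — «a closed
subgroup of finite index of a topological group is open» (`Subgroup.isOpen_of_isClosed_of_finiteIndex`)
inside the cuspidal inertia `I_x`.

HONEST FRAMING.  The printed case (`Π^temp` a non-compact tempered group, `ι` a proper dense injection) is
NOT the surjective regime; this file is tightness / non-vacuity bookkeeping for the F-1708 producer, proves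
nothing of [Mzk8] or [SemiAnbd] for curves, and takes no side on [IUTchIII] Cor. 3.12; typed ≠ proved.
-/

noncomputable section

namespace Literature.AnabelianGeometry.SemiGraphs

namespace TemperedCurve

open scoped Pointwise
open _root_.Topology
open Subgroup.Commensurable (commensurator)

variable {p : ℕ} [Fact p.Prime] (X : TemperedCurve p)

/-! ### Bookkeeping in the surjective regime -/

/-- When `ι` is onto, every `Π_{X_K}`-conjugate of an image is the image of a `Π^temp`-conjugate.
[cite: MochizukiSemiAnbd2006, §6 p.71] -/
theorem exists_smul_map_toHat_eq (hsurj : Function.Surjective X.toHat) (γ : ConjAct X.PiHat)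
    (H : Subgroup X.PiTemp) :
    ∃ δ : ConjAct X.PiTemp, γ • H.map X.toHat.toMonoidHom = (δ • H).map X.toHat.toMonoidHom := by
  obtain ⟨g, hg⟩ := hsurj (ConjAct.ofConjAct γ)
  refine ⟨ConjAct.toConjAct g, ?_⟩
  rw [map_toHat_conjAct_smul, ConjAct.ofConjAct_toConjAct, hg, ConjAct.toConjAct_ofConjAct]

/-- When `ι` is onto (and injective, interface axiom), a commensurator identity `C_{Π^temp}(H) = K`
transfers FORWARD to `C_{Π_{X_K}}(ι H) = ι K`. [cite: MochizukiSemiAnbd2006, Thm 6.5(ii) p.71] -/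
theorem commensurator_map_toHat_eq_of_surjective (hsurj : Function.Surjective X.toHat)
    {H K : Subgroup X.PiTemp} (h : commensurator H = K) :
    commensurator (H.map X.toHat.toMonoidHom) = K.map X.toHat.toMonoidHom := by
  ext y
  obtain ⟨g, rfl⟩ := hsurj y
  change X.toHat.toMonoidHom g ∈ _ ↔ X.toHat.toMonoidHom g ∈ _
  rw [map_mem_commensurator_map_iff X.toHat_toMonoidHom_injective H g, h]
  exact (Subgroup.mem_map_iff_mem X.toHat_toMonoidHom_injective).symm

/-! ### The five binders FROM the five typed clauses, when `ι` is onto -/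

/-- [Mzk8] Thm. 1.3 (i), first sentence, for the images — the binder `h13i` — from the typed
`X.DecompDeterminesPoint`, when `ι` is onto. [cite: MochizukiSemiAnbd2006, Thm 6.5(i) p.71] -/
theorem decompDeterminesPoint_hat_of_toHat_surjective (hsurj : Function.Surjective X.toHat)
    (h : X.DecompDeterminesPoint) :
    ∀ x x' : X.Pt, (∃ γ : ConjAct X.PiHat,
      (X.decomp x').map X.toHat.toMonoidHom = γ • (X.decomp x).map X.toHat.toMonoidHom) → x' = x := by
  rintro x x' ⟨γ, hγ⟩
  obtain ⟨δ, hδ⟩ := X.exists_smul_map_toHat_eq hsurj γ (X.decomp x)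
  rw [hδ] at hγ
  exact h x x' ⟨δ, Subgroup.map_injective X.toHat_toMonoidHom_injective hγ⟩

/-- [Mzk8] Thm. 1.3 (i), second sentence, for `Î_x = ι(D_x) ∩ Ker(augHat)` — the binder `h13i'` — from
the typed `X.InertiaDeterminesCusp`, when `ι` is onto. [cite: MochizukiSemiAnbd2006, Thm 6.5(i) p.71] -/
theorem inertiaDeterminesCusp_hat_of_toHat_surjective (hsurj : Function.Surjective X.toHat)
    (h : X.InertiaDeterminesCusp) :
    ∀ x x' : X.Pt, X.IsCusp x → (∃ γ : ConjAct X.PiHat,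
      (X.decomp x').map X.toHat.toMonoidHom ⊓ X.augHat.toMonoidHom.ker =
        γ • ((X.decomp x).map X.toHat.toMonoidHom ⊓ X.augHat.toMonoidHom.ker)) → x' = x := by
  rintro x x' hx ⟨γ, hγ⟩
  rw [← map_toHat_inertia, ← map_toHat_inertia] at hγ
  obtain ⟨δ, hδ⟩ := X.exists_smul_map_toHat_eq hsurj γ (X.inertia x)
  rw [hδ] at hγ
  exact h x x' hx ⟨δ, Subgroup.map_injective X.toHat_toMonoidHom_injective hγ⟩

/-- [Mzk8] Thm. 1.3 (ii), first sentence, for the images — the binder `h13ii` — from the typed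
`X.DecompCommensurablyTerminal`, when `ι` is onto. [cite: MochizukiSemiAnbd2006, Thm 6.5(ii) p.71] -/
theorem decompCommensurablyTerminal_hat_of_toHat_surjective (hsurj : Function.Surjective X.toHat)
    (h : X.DecompCommensurablyTerminal) :
    ∀ x : X.Pt, commensurator ((X.decomp x).map X.toHat.toMonoidHom) =
      (X.decomp x).map X.toHat.toMonoidHom := fun x =>
  X.commensurator_map_toHat_eq_of_surjective hsurj (h x)

/-- [Mzk8] Thm. 1.3 (ii), second sentence, for the images — the binder `h13ii'` (shape of the tree's
`GalSect.Thm_1_3_ii_cusps`: every CLOSED finite-index `H ⊆ Î_x` has `C_{Π_{X_K}}(H) = D̂_x`) — from the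
typed `X.DecompEqCommensuratorOfOpenInertia`, when `ι` is onto: the preimage of such an `H` is a closed
subgroup of finite index of the cuspidal inertia `I_x`, hence OPEN in `I_x`
(`Subgroup.isOpen_of_isClosed_of_finiteIndex`). [cite: MochizukiSemiAnbd2006, Thm 6.5(ii) p.71] -/
theorem decompEqCommensuratorOfOpenInertia_hat_of_toHat_surjective (hsurj : Function.Surjective X.toHat)
    (h : X.DecompEqCommensuratorOfOpenInertia) :
    ∀ x : X.Pt, X.IsCusp x → ∀ H : Subgroup X.PiHat,
      H ≤ (X.decomp x).map X.toHat.toMonoidHom ⊓ X.augHat.toMonoidHom.ker →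
        IsClosed (H : Set X.PiHat) →
          (H.subgroupOf ((X.decomp x).map X.toHat.toMonoidHom ⊓ X.augHat.toMonoidHom.ker)).FiniteIndex →
            commensurator H = (X.decomp x).map X.toHat.toMonoidHom := by
  intro x hx H hHI hHc hHf
  have hinj := X.toHat_toMonoidHom_injective
  -- the preimage `H₀ ⊆ I_x` of `H`, with `ι(H₀) = H`
  set H₀ : Subgroup X.PiTemp := H.comap X.toHat.toMonoidHom with hH₀
  have hmap : H₀.map X.toHat.toMonoidHom = H := Subgroup.map_comap_eq_self_of_surjective hsurj H
  rw [← map_toHat_inertia] at hHI hHf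
  have hle : H₀ ≤ X.inertia x := by
    have := Subgroup.comap_mono (f := X.toHat.toMonoidHom) hHI
    rwa [Subgroup.comap_map_eq_self_of_injective hinj] at this
  -- `H₀ ∩ I_x` is closed of finite index in `I_x`, hence open
  have hfi : (H₀.subgroupOf (X.inertia x)).FiniteIndex := by
    refine ⟨?_⟩
    change H₀.relIndex (X.inertia x) ≠ 0
    rw [← Subgroup.relIndex_map_map_of_injective _ _ hinj, hmap]
    exact Subgroup.FiniteIndex.index_ne_zero
  have hcl : IsClosed ((H₀.subgroupOf (X.inertia x) : Subgroup (X.inertia x)) : Set (X.inertia x)) := by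
    have h1 : IsClosed (H₀ : Set X.PiTemp) := by
      rw [hH₀, Subgroup.coe_comap]
      exact hHc.preimage X.toHat.continuous
    exact h1.preimage continuous_subtype_val
  haveI := hfi
  have hopen : IsOpen ((H₀.subgroupOf (X.inertia x) : Subgroup (X.inertia x)) : Set (X.inertia x)) :=
    Subgroup.isOpen_of_isClosed_of_finiteIndex _ hcl
  -- the typed clause for `H₀`, transferred forward
  have key := h x hx H₀ hle hopen
  rw [← hmap]
  exact X.commensurator_map_toHat_eq_of_surjective hsurj key

/-- [Mzk8] Thm. 1.3 (iv) for the images — the binder `h13iv` — from the typed `X.NoncuspidalNotLeCuspidal`,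
when `ι` is onto. [cite: MochizukiSemiAnbd2006, Thm 6.5(iv) p.72] -/
theorem noncuspidalNotLeCuspidal_hat_of_toHat_surjective (hsurj : Function.Surjective X.toHat)
    (h : X.NoncuspidalNotLeCuspidal) :
    ∀ x x' : X.Pt, ¬ X.IsCusp x → X.IsCusp x' → ∀ γ γ' : ConjAct X.PiHat,
      ¬ (γ • (X.decomp x).map X.toHat.toMonoidHom ≤ γ' • (X.decomp x').map X.toHat.toMonoidHom) := by
  intro x x' hx hx' γ γ' hle
  obtain ⟨δ, hδ⟩ := X.exists_smul_map_toHat_eq hsurj γ (X.decomp x)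
  obtain ⟨δ', hδ'⟩ := X.exists_smul_map_toHat_eq hsurj γ' (X.decomp x')
  rw [hδ, hδ', Subgroup.map_le_map_iff_of_injective X.toHat_toMonoidHom_injective] at hle
  exact h x x' hx hx' δ δ' hle

/-! ### The equivalence in the surjective regime -/

/-- **The five [Mzk8] Thm. 1.3 binders of `temperedDecompositionGroups_of_profinite` FROM the five typed
clauses of [SemiAnbd] Thm. 6.5 (i)(ii)(iv), when `ι = Π^temp_{X_K} → Π_{X_K}` is onto** (e.g. `Π^temp`
compact). [cite: MochizukiSemiAnbd2006, Thm 6.5 pp.71-72] -/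
theorem temperedDecompositionGroups_hat_of_toHat_surjective (hsurj : Function.Surjective X.toHat)
    (h : X.DecompDeterminesPoint ∧ X.InertiaDeterminesCusp ∧ X.DecompCommensurablyTerminal ∧
      X.DecompEqCommensuratorOfOpenInertia ∧ X.NoncuspidalNotLeCuspidal) :
    (∀ x x' : X.Pt, (∃ γ : ConjAct X.PiHat,
        (X.decomp x').map X.toHat.toMonoidHom = γ • (X.decomp x).map X.toHat.toMonoidHom) → x' = x) ∧
    (∀ x x' : X.Pt, X.IsCusp x → (∃ γ : ConjAct X.PiHat,
        (X.decomp x').map X.toHat.toMonoidHom ⊓ X.augHat.toMonoidHom.ker =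
          γ • ((X.decomp x).map X.toHat.toMonoidHom ⊓ X.augHat.toMonoidHom.ker)) → x' = x) ∧
    (∀ x : X.Pt, commensurator ((X.decomp x).map X.toHat.toMonoidHom) =
      (X.decomp x).map X.toHat.toMonoidHom) ∧
    (∀ x : X.Pt, X.IsCusp x → ∀ H : Subgroup X.PiHat,
      H ≤ (X.decomp x).map X.toHat.toMonoidHom ⊓ X.augHat.toMonoidHom.ker →
        IsClosed (H : Set X.PiHat) →
          (H.subgroupOf ((X.decomp x).map X.toHat.toMonoidHom ⊓ X.augHat.toMonoidHom.ker)).FiniteIndex →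
            commensurator H = (X.decomp x).map X.toHat.toMonoidHom) ∧
    (∀ x x' : X.Pt, ¬ X.IsCusp x → X.IsCusp x' → ∀ γ γ' : ConjAct X.PiHat,
      ¬ (γ • (X.decomp x).map X.toHat.toMonoidHom ≤ γ' • (X.decomp x').map X.toHat.toMonoidHom)) :=
  ⟨X.decompDeterminesPoint_hat_of_toHat_surjective hsurj h.1,
    X.inertiaDeterminesCusp_hat_of_toHat_surjective hsurj h.2.1,
    X.decompCommensurablyTerminal_hat_of_toHat_surjective hsurj h.2.2.1,
    X.decompEqCommensuratorOfOpenInertia_hat_of_toHat_surjective hsurj h.2.2.2.1,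
    X.noncuspidalNotLeCuspidal_hat_of_toHat_surjective hsurj h.2.2.2.2⟩

/-- **[SemiAnbd] Thm. 6.5 (i)(ii)(iv) for `Π^temp_{X_K}` ⇔ [Mzk8] Thm. 1.3 (i)(ii)(iv) for the images in
`Π_{X_K}`, when `ι` is onto**: in the surjective regime the F-1708 reduction
`temperedDecompositionGroups_of_profinite` is an equivalence (tightness; and non-vacuity of its binders
follows from any compact model of the typed clauses). [cite: MochizukiSemiAnbd2006, Thm 6.5 pp.71-72] -/
theorem temperedDecompositionGroups_iff_of_toHat_surjective (hsurj : Function.Surjective X.toHat) :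
    (X.DecompDeterminesPoint ∧ X.InertiaDeterminesCusp ∧ X.DecompCommensurablyTerminal ∧
      X.DecompEqCommensuratorOfOpenInertia ∧ X.NoncuspidalNotLeCuspidal) ↔
    ((∀ x x' : X.Pt, (∃ γ : ConjAct X.PiHat,
        (X.decomp x').map X.toHat.toMonoidHom = γ • (X.decomp x).map X.toHat.toMonoidHom) → x' = x) ∧
    (∀ x x' : X.Pt, X.IsCusp x → (∃ γ : ConjAct X.PiHat,
        (X.decomp x').map X.toHat.toMonoidHom ⊓ X.augHat.toMonoidHom.ker =
          γ • ((X.decomp x).map X.toHat.toMonoidHom ⊓ X.augHat.toMonoidHom.ker)) → x' = x) ∧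
    (∀ x : X.Pt, commensurator ((X.decomp x).map X.toHat.toMonoidHom) =
      (X.decomp x).map X.toHat.toMonoidHom) ∧
    (∀ x : X.Pt, X.IsCusp x → ∀ H : Subgroup X.PiHat,
      H ≤ (X.decomp x).map X.toHat.toMonoidHom ⊓ X.augHat.toMonoidHom.ker →
        IsClosed (H : Set X.PiHat) →
          (H.subgroupOf ((X.decomp x).map X.toHat.toMonoidHom ⊓ X.augHat.toMonoidHom.ker)).FiniteIndex →
            commensurator H = (X.decomp x).map X.toHat.toMonoidHom) ∧
    (∀ x x' : X.Pt, ¬ X.IsCusp x → X.IsCusp x' → ∀ γ γ' : ConjAct X.PiHat,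
      ¬ (γ • (X.decomp x).map X.toHat.toMonoidHom ≤ γ' • (X.decomp x').map X.toHat.toMonoidHom))) :=
  ⟨X.temperedDecompositionGroups_hat_of_toHat_surjective hsurj,
    fun h => X.temperedDecompositionGroups_of_profinite h.1 h.2.1 h.2.2.1 h.2.2.2.1 h.2.2.2.2⟩

end TemperedCurve

end Literature.AnabelianGeometry.SemiGraphs

end
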